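import Literature.NumberTheory.GaloisCohomology.PoitouTateSelmerStructuresCharacterLift
import Literature.NumberTheory.GaloisCohomology.PoitouTateSelmerStructuresRealPlaces
import Literature.NumberTheory.GaloisCohomology.LocalInvariantsRigidityCriterion
import Mathlib.NumberTheory.NumberField.InfinitePlace.TotallyRealComplex
import HarnessLib

/-!
# Milne I 4.10(b) `⊇`, one-place lift — for THE canonical family of invariant maps, from the tree's five-conjunct
# Poitou–Tate fact `poitouTate_selmerStructure_duality_real` (totally real base field)

Topic `NumberTheory/GaloisCohomology`; namespace `Literature.NumberTheory.GaloisCohomology.LocalInvariants`.  PROOF FILE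
(theorems only; no definition, no named fact, no instance; base field and module in `Type`, the universe of `LocalInvariantsRigidityCriterion`).  Cell `bsd-wall`, lead prover `bsd-wall-tp2-p2` g10, for the
(S_PT) kernel route of crux stmt-BirchSwinnertonDyer-26471 (brick (E), hypothesis `hE` of
`Summit.…Theorems.SignedLowerOffTwo.PTDeep.poitouTateDeepTwo_of_levelwise_exists`): the finite-level Poitou–Tate input of
that route must be stated against THE canonical pairing `LocalInvariants.canonical K n` (its value at the place over `p` IS
the layer pairing `CyclotomicLayer.layerPairingMod`), while the tree's named fact asserts the duality for SOME family
`inv`.  This file removes the gap: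

* `dualLocalCondition_eq_of_forall_apply_eq_zero_iff` — two invariant maps with the same kernel condition define the same
  dual local condition;
* `dualSelmerStructure_eq_canonical` — for `K` totally real, a family with `IsPerfect` (so `inv_v = a_v · can_v`, `a_v` a unit,
  at the finite places: `exists_eq_mul_localInvariantMap`, `isUnit_of_isPerfect_of_eq_mul`) and `InjectiveAtRealPlaces`
  (so `inv_w` and `can_w` are both injective at the real places, `canonical_injectiveAtRealPlaces`) has the SAME dual Selmer
  structures as the canonical family;
* **`exists_selmer_canonical_localTatePairing_eq_of_subgroup`** — the one-place lift
  `SelmerComplement.exists_selmer_localTatePairing_eq_of_subgroup` (w2's B4-core) with every occurrence of `inv` replaced by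
  `LocalInvariants.canonical K n`, under the hypothesis `poitouTate_selmerStructure_duality_real K` (the character is
  pre-twisted by the unit `a_{v₀}`).

References: [MilneADT2006] I Ex. 1.6 (c), Cor. 2.3, Thm. 2.13, Thm. 4.10 (b); [Howard2004HeegnerKolyvagin] Thm. 2.1.11;
[CasselsFrohlichANT1967] Ch. VI §1.1.
-/

noncomputable section

open Function NumberField IsDedekindDomain
open scoped NumberField

namespace Literature.NumberTheory.GaloisCohomology

open Literature.NumberTheory.GaloisRepresentations
open Literature.NumberTheory.GaloisRepresentations.DiscreteGaloisModule (localTatePairingZMod tateDual SelmerStructure)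

variable {K : Type} [Field K] [NumberField K]

namespace LocalInvariants

variable {n : ℕ} {M : Type} [AddCommGroup M] [TopologicalSpace M] [DiscreteTopology M] [Finite M]

/-! ### §1 Dual local conditions only depend on the kernel condition of the invariant map -/

/-- Two invariant maps at `v` with `inv c = 0 ↔ inv' c = 0` for all `c ∈ H²(K_v, μₙ)` define the same dual local condition of
every local condition `L`. [cite: Howard2004HeegnerKolyvagin, Def. 2.1.6 (arXiv:1202.6340 p. 5)] -/
theorem dualLocalCondition_eq_of_forall_apply_eq_zero_iff (inv inv' : LocalInvariants K n) (ρ : DiscreteGaloisModule K M)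
    (v : Place K) (h : ∀ c, inv v c = 0 ↔ inv' v c = 0) (L : AddSubgroup (galoisCohomology (ρ.toLocal v) 1)) :
    inv.dualLocalCondition ρ v L = inv'.dualLocalCondition ρ v L := by
  ext b
  simp only [mem_dualLocalCondition_iff, DiscreteGaloisModule.localTatePairingZMod_apply, h]

/-- At a finite place, a family with `IsPerfect` has the same kernel condition as THE invariant map (`inv_v = a_v · can_v` with
`a_v` a unit). [cite: MilneADT2006, Ch. I, Cor. 2.3] [cite: CasselsFrohlichANT1967, Ch. VI §1.1] -/
theorem apply_eq_zero_iff_canonical_inr (inv : LocalInvariants K n) [NeZero n] (hperf : inv.IsPerfect)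
    (v : HeightOneSpectrum (𝓞 K)) (c : galoisCohomology ((DiscreteGaloisModule.mu K n).toLocal (Sum.inr v)) 2) :
    inv (Sum.inr v) c = 0 ↔ canonical K n (Sum.inr v) c = 0 := by
  obtain ⟨a, ha⟩ := inv.exists_eq_mul_localInvariantMap v
  have hau : IsUnit a := inv.isUnit_of_isPerfect_of_eq_mul hperf v ha
  rw [ha, canonical_inr]
  exact hau.mul_right_eq_zero

/-- At a real place, a family injective at the real places has the same kernel condition as THE (injective) archimedean
invariant map. [cite: MilneADT2006, Ch. I, Ex. 1.6 (c)] -/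
theorem apply_eq_zero_iff_canonical_inl (inv : LocalInvariants K n) [NeZero n] (hinj : inv.InjectiveAtRealPlaces)
    {w : InfinitePlace K} (hw : w.IsReal) (c : galoisCohomology ((DiscreteGaloisModule.mu K n).toLocal (Sum.inl w)) 2) :
    inv (Sum.inl w) c = 0 ↔ canonical K n (Sum.inl w) c = 0 := by
  constructor
  · intro h
    have hc : c = 0 := (hinj.injective hw) (h.trans (map_zero _).symm)
    rw [hc, map_zero]
  · intro h
    have hc : c = 0 := ((canonical_injectiveAtRealPlaces (K := K) (n := n)).injective hw) (h.trans (map_zero _).symm)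
    rw [hc, map_zero]

/-- **Same dual Selmer structures as the canonical family** (totally real `K`): `IsPerfect` + `InjectiveAtRealPlaces` ⇒
`inv^* 𝓕 = can^* 𝓕`. [cite: MilneADT2006, Ch. I, Ex. 1.6 (c) and Cor. 2.3] -/
theorem dualSelmerStructure_eq_canonical [IsTotallyReal K] [NeZero n] (inv : LocalInvariants K n)
    (hperf : inv.IsPerfect) (hinj : inv.InjectiveAtRealPlaces) (ρ : DiscreteGaloisModule K M) (𝓕 : SelmerStructure ρ) :
    inv.dualSelmerStructure ρ 𝓕 = (canonical K n).dualSelmerStructure ρ 𝓕 := by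
  funext v
  rw [dualSelmerStructure_apply, dualSelmerStructure_apply]
  refine dualLocalCondition_eq_of_forall_apply_eq_zero_iff inv (canonical K n) ρ v (fun c ↦ ?_) (𝓕 v)
  cases v with
  | inl w => exact apply_eq_zero_iff_canonical_inl inv hinj (IsTotallyReal.isReal w) c
  | inr v => exact apply_eq_zero_iff_canonical_inr inv hperf v c

/-! ### §2 The one-place lift for THE canonical pairing -/

/-- **One-place lift of a character of a subgroup, CANONICAL pairing** (Milne I 4.10 (b) `⊇` through the five-conjunct fact).
For `K` totally real with `poitouTate_selmerStructure_duality_real K`; `M` finite killed by `n ≥ 1`; `S`, `𝓕 ≤ 𝓖` unramified outside `S`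
as in `SelmerComplement`; `v₀ ∈ S` finite with `𝓖_{v₀} = ⊤` and `𝓕_{v₀} = C^⊥` for THE local Tate pairing at `v₀`; a character `χ : C → ℤ/n`
killing every `loc_{v₀} y ∈ C`, `y` in the dual Selmer group of `𝓕` FOR THE CANONICAL FAMILY: some `x ∈ H¹_𝓖(K, M)` has
`⟨loc_{v₀} x, c⟩^{can}_{v₀} = χ c` on `C` and `loc_v x ∈ 𝓕_v` at the other `v ∈ S`.  Proof: pick the family `inv` of the fact; its dual Selmer
structures are the canonical ones (§1); apply `SelmerComplement.exists_selmer_localTatePairing_eq_of_subgroup` to the character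
`a_{v₀} · χ` (`inv_{v₀} = a_{v₀} · can_{v₀}`, `a_{v₀}` a unit) and cancel the unit.
[cite: MilneADT2006, Ch. I, Thm. 4.10(b)] [cite: Howard2004HeegnerKolyvagin, Thm. 2.1.11 (arXiv:1202.6340 p. 6)] -/
theorem exists_selmer_canonical_localTatePairing_eq_of_subgroup [IsTotallyReal K] [NeZero n]
    (hPT : poitouTate_selmerStructure_duality_real K) (ρ : DiscreteGaloisModule K M)
    (hM : ∀ m : M, n • m = 0) {S : Finset (Place K)}
    (hS : ∀ v : HeightOneSpectrum (𝓞 K), (Sum.inr v : Place K) ∉ S →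
      ((n : ℕ) : 𝓞 K) ∉ v.asIdeal ∧ GaloisRep.IsUnramifiedAt v ρ)
    {𝓕 𝓖 : SelmerStructure ρ} (hle : 𝓕 ≤ 𝓖) (h𝓕 : 𝓕.IsUnramifiedOutside S)
    (h𝓖 : 𝓖.IsUnramifiedOutside S) {v₀ : HeightOneSpectrum (𝓞 K)} (hv₀ : (Sum.inr v₀ : Place K) ∈ S)
    (h𝓖v : 𝓖 (Sum.inr v₀) = ⊤)
    (C : AddSubgroup (galoisCohomology ((ρ.tateDual n).toLocal (Sum.inr v₀)) 1))
    (h𝓕v : ∀ a, a ∈ 𝓕 (Sum.inr v₀) ↔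
      ∀ c ∈ C, localTatePairingZMod ρ n (Sum.inr v₀) (canonical K n (Sum.inr v₀)) a c = 0)
    (χ : C →+ ZMod n)
    (hχ : ∀ y ∈ ((canonical K n).dualSelmerStructure ρ 𝓕).selmerGroup,
      ∀ hy : galoisCohomology.localization (ρ.tateDual n) (Sum.inr v₀) 1 y ∈ C,
        χ ⟨galoisCohomology.localization (ρ.tateDual n) (Sum.inr v₀) 1 y, hy⟩ = 0) :
    ∃ x ∈ 𝓖.selmerGroup,
      (∀ (c) (hc : c ∈ C), localTatePairingZMod ρ n (Sum.inr v₀) (canonical K n (Sum.inr v₀))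
        (galoisCohomology.localization ρ (Sum.inr v₀) 1 x) c = χ ⟨c, hc⟩) ∧
      ∀ v ∈ S, v ≠ Sum.inr v₀ → galoisCohomology.localization ρ v 1 x ∈ 𝓕 v := by
  obtain ⟨inv, hperf, -, -, hSC, hinj⟩ := hPT n
  obtain ⟨a, ha⟩ := inv.exists_eq_mul_localInvariantMap v₀
  have hau : IsUnit a := inv.isUnit_of_isPerfect_of_eq_mul hperf v₀ ha
  -- the `inv`-pairing at `v₀` is `a ·` the canonical one
  have hpair : ∀ (x : galoisCohomology (ρ.toLocal (Sum.inr v₀)) 1) (c : galoisCohomology ((ρ.tateDual n).toLocal (Sum.inr v₀)) 1),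
      localTatePairingZMod ρ n (Sum.inr v₀) (inv (Sum.inr v₀)) x c =
        a * localTatePairingZMod ρ n (Sum.inr v₀) (canonical K n (Sum.inr v₀)) x c := fun x c ↦ by
    rw [DiscreteGaloisModule.localTatePairingZMod_apply, DiscreteGaloisModule.localTatePairingZMod_apply, ha, canonical_inr]
  -- `𝓕_{v₀} = C^⊥` for `inv` as well
  have h𝓕v' : ∀ x, x ∈ 𝓕 (Sum.inr v₀) ↔
      ∀ c ∈ C, localTatePairingZMod ρ n (Sum.inr v₀) (inv (Sum.inr v₀)) x c = 0 := fun x ↦ by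
    rw [h𝓕v x]
    refine forall_congr' fun c ↦ forall_congr' fun _ ↦ ?_
    rw [hpair, hau.mul_right_eq_zero]
  -- the dual Selmer structures agree
  have hdual := dualSelmerStructure_eq_canonical inv hperf hinj ρ 𝓕
  -- the pre-twisted character
  let χ' : C →+ ZMod n := (AddMonoidHom.mulLeft a).comp χ
  have hχ' : ∀ y ∈ (inv.dualSelmerStructure ρ 𝓕).selmerGroup,
      ∀ hy : galoisCohomology.localization (ρ.tateDual n) (Sum.inr v₀) 1 y ∈ C,
        χ' ⟨galoisCohomology.localization (ρ.tateDual n) (Sum.inr v₀) 1 y, hy⟩ = 0 := by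
    intro y hy hyC
    rw [hdual] at hy
    change a * χ ⟨_, hyC⟩ = 0
    rw [hχ y hy hyC, mul_zero]
  obtain ⟨x, hx, hval, hrest⟩ :=
    hSC.exists_selmer_localTatePairing_eq_of_subgroup hperf ρ hM hS hle h𝓕 h𝓖 hv₀ h𝓖v C h𝓕v' χ' hχ'
  refine ⟨x, hx, fun c hc ↦ ?_, hrest⟩
  have h1 := hval c hc
  rw [hpair] at h1
  -- cancel the unit `a`
  exact hau.mul_left_cancel h1

end LocalInvariants

end Literature.NumberTheory.GaloisCohomology

end
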